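import Summits.AnomalousDissipation.AnomalousDissipation.Theorems.SawtoothPulseCascadeK1LocalisedCascadeLineRefineCascadeLt

/-!
# K1loc, line `Spectral` — S-D: THE WINDOW INTEGRAL OVER A REFINED CHORD (input of the strip channel)

Helper file of the prover lane on the crux `K1LocalisedCascade` (stmt-AnomalousDissipation-19491), route
`SawtoothPulseCascade`, registered line `Cruxes.K1LocalisedCascade.Spectral` (one open stub `stub_highModeConcentration`).
The strip channel of the released-energy target (`K1Ledger.From.k1Localised_of_thin_released_energy`, memo v8 §10) is consumed by
`K1Start.tsum_strip_le_windowAvg` (ad-k1loc-p3): `Σ_{|k₀| ≤ L} |𝓕v(k)|² ≤ (πL)² ∫ |∫_{−1/(4L)}^{1/(4L)} v(x + u e₀) du|² dx`.  This file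
provides the pointwise input: the integral of `sin(2πφ)` over a SUB-INTERVAL `[α, β]` of a refined chord is bounded cell-wise by
`Σ_i min(|I_i ∩ [α,β]|, 1/(π|k_i|)) + 2πE(β − α) + |D ∩ [α, β]|` (`norm_window_integral_le`, the window version of
`…ChordSum.norm_chord_integral_le`), and its instantiation on the cascade chord (`window_sum_le_lt`: the refinement of
`…LineRefineCascadeLt.lineRefine_cascade_lt` exposed together with the window inequality for all `0 ≤ α ≤ β ≤ 1`).

[cite: ElgindiLissMattingly2025, §1.2.2, §3.1] [cite: Grafakos2014, Prop. 3.1.2] [problem: turb]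
-/

-- `Summit.<Summit>.<Problem>`: single-conjunct summit, the duplicate namespace segment is deliberate.
set_option linter.dupNamespace false

noncomputable section

namespace Summit.AnomalousDissipation.AnomalousDissipation.Theorems.SawtoothPulseCascade.K1Start

open Set MeasureTheory intervalIntegral Complex Function
open Literature.Analysis Literature.Analysis.FunctionSpaces Literature.Analysis.FunctionSpaces.Torus
open Literature.Analysis.FluidPDE.ShearStage
open Literature.Analysis.FluidPDE.SawtoothCascade Literature.Analysis.FluidPDE.SawtoothCascade.CascadeParams

/-! ## §1 One piece inside a window -/

/-- One affine piece of a window: `‖∫_a^b sin(2πφ)‖ ≤ min(b − a, 1/(π|k|)) + 2πE(b − a)` when `|φ(s) − φ(a) − k(s − a)| ≤ E` on `[a, b]`,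
`k ≠ 0`, `E ≥ 0`. [cite: Grafakos2014, Prop. 3.1.2] -/
theorem norm_integral_sin_piece_le {φ : ℝ → ℝ} (hφ : Continuous φ) {k E a b : ℝ} (hab : a ≤ b) (hk : k ≠ 0) (hE : 0 ≤ E)
    (haff : ∀ s ∈ Icc a b, ∀ s' ∈ Icc a b, |φ s' - φ s - k * (s' - s)| ≤ E) :
    ‖∫ s in a..b, (Real.sin (2 * Real.pi * φ s) : ℂ)‖ ≤ min (b - a) (1 / (Real.pi * |k|)) + 2 * Real.pi * E * (b - a) := by
  have htriv : ‖∫ s in a..b, (Real.sin (2 * Real.pi * φ s) : ℂ)‖ ≤ b - a := by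
    refine (intervalIntegral.norm_integral_le_of_norm_le_const (C := 1) fun s _ => ?_).trans (by rw [abs_of_nonneg (sub_nonneg.2 hab), one_mul])
    rw [Complex.norm_real, Real.norm_eq_abs]
    exact Real.abs_sin_le_one _
  have hosc : ‖∫ s in a..b, (Real.sin (2 * Real.pi * φ s) : ℂ)‖ ≤ 1 / (Real.pi * |k|) + 2 * Real.pi * E * (b - a) := by
    have hε : ∀ s ∈ Icc a b, |φ s - (k * s + (φ a - k * a))| ≤ E := by
      intro s hs
      have h := haff a (left_mem_Icc.mpr hab) s hs
      rwa [show φ s - (k * s + (φ a - k * a)) = φ s - φ a - k * (s - a) by ring]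
    have h := norm_integral_sin_phase_mul_exp_le hφ hab (m := 0) hk (by rwa [neg_zero]) hε
    have e : (fun s => (Real.sin (2 * Real.pi * φ s) : ℂ) * exp (-(2 * Real.pi * I * ((0 : ℝ) * s)))) =
        fun s => (Real.sin (2 * Real.pi * φ s) : ℂ) := by
      funext s; simp
    rw [e, sub_zero, add_zero] at h
    linarith
  have h2 : 0 ≤ 2 * Real.pi * E * (b - a) := by have := Real.pi_pos; have := sub_nonneg.2 hab; positivity
  rcases le_total (b - a) (1 / (Real.pi * |k|)) with h | h
  · rw [min_eq_left h]; linarith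
  · rw [min_eq_right h]; exact hosc

/-! ## §2 The window integral over a refined chord -/

/-- **The window integral over a refined chord.**  Let `φ` be continuous, `[u_i, v_i]` (`i ∈ S`) pairwise disjoint pieces on which
`|φ(s′) − φ(s) − k_i(s′ − s)| ≤ E` (`E ≥ 0`, `k_i ≠ 0`), and suppose every `s ∈ [0, 1]` outside the pieces lies in `D`.  Then for
`0 ≤ α ≤ β ≤ 1`: `‖∫_α^β sin(2πφ)‖ ≤ Σ_i min(|[u_i,v_i] ∩ [α,β]|, 1/(π|k_i|)) + 2πE(β − α) + |D ∩ [α, β]|`. [cite: Grafakos2014, Prop. 3.1.2] -/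
theorem norm_window_integral_le {φ : ℝ → ℝ} (hφ : Continuous φ) {ι : Type*} (S : Finset ι) (u v k : ι → ℝ) {E : ℝ} (hE : 0 ≤ E)
    (hdisj : ∀ i ∈ S, ∀ i' ∈ S, i ≠ i' → Disjoint (Icc (u i) (v i)) (Icc (u i') (v i')))
    (haff : ∀ i ∈ S, ∀ s ∈ Icc (u i) (v i), ∀ s' ∈ Icc (u i) (v i), |φ s' - φ s - k i * (s' - s)| ≤ E)
    (hk : ∀ i ∈ S, k i ≠ 0) (D : Set ℝ) (hcover : ∀ s ∈ Icc (0 : ℝ) 1, (∃ i ∈ S, s ∈ Icc (u i) (v i)) ∨ s ∈ D)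
    {α β : ℝ} (hα : 0 ≤ α) (hαβ : α ≤ β) (hβ : β ≤ 1) :
    ‖∫ s in α..β, (Real.sin (2 * Real.pi * φ s) : ℂ)‖ ≤
      ∑ i ∈ S, min (max 0 (min (v i) β - max (u i) α)) (1 / (Real.pi * |k i|)) + 2 * Real.pi * E * (β - α) +
        (volume (D ∩ Icc α β)).toReal := by
  have hπ := Real.pi_pos
  set F : ℝ → ℂ := fun s => (Real.sin (2 * Real.pi * φ s) : ℂ) with hF
  have hFc : Continuous F := Complex.continuous_ofReal.comp (Real.continuous_sin.comp (continuous_const.mul hφ))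
  have hF1 : ∀ s, ‖F s‖ ≤ 1 := fun s => by
    rw [hF, Complex.norm_real, Real.norm_eq_abs]; exact Real.abs_sin_le_one _
  have hFi : ∀ A : Set ℝ, volume A < ⊤ → IntegrableOn F A volume := fun A hA =>
    Measure.integrableOn_of_bounded (M := 1) hA.ne hFc.aestronglyMeasurable (Filter.Eventually.of_forall hF1)
  -- the pieces cut to the window
  set a : ι → ℝ := fun i => max (u i) α with ha
  set b : ι → ℝ := fun i => min (v i) β with hb
  have hcut : ∀ i, Icc (u i) (v i) ∩ Icc α β = Icc (a i) (b i) := fun i => Icc_inter_Icc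
  set U : Set ℝ := ⋃ i ∈ S, Icc (a i) (b i) with hU
  have hUmeas : MeasurableSet U := Finset.measurableSet_biUnion S fun i _ => measurableSet_Icc
  have hUsub : U ⊆ Icc α β := iUnion₂_subset fun i _ => by rw [← hcut]; exact inter_subset_right
  have hvolw : volume (Icc α β) < ⊤ := by rw [Real.volume_Icc]; exact ENNReal.ofReal_lt_top
  have hdisj' : ∀ i ∈ S, ∀ i' ∈ S, i ≠ i' → Disjoint (Icc (a i) (b i)) (Icc (a i') (b i')) := fun i hi i' hi' hne => by
    rw [← hcut, ← hcut]
    exact Disjoint.mono inter_subset_left inter_subset_left (hdisj i hi i' hi' hne)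
  -- split the integral
  have hsplit : ∫ s in α..β, F s = (∑ i ∈ S, ∫ s in Icc (a i) (b i), F s) + ∫ s in Icc α β \ U, F s := by
    rw [intervalIntegral.integral_of_le hαβ, ← integral_Icc_eq_integral_Ioc, setIntegral_sdiff hUmeas (hFi _ hvolw) hUsub, hU,
      integral_biUnion_finset S (fun i _ => measurableSet_Icc) (fun i hi i' hi' hne => hdisj' i hi i' hi' hne)
        (fun i _ => hFi _ (by rw [Real.volume_Icc]; exact ENNReal.ofReal_lt_top))]
    ring
  -- each piece
  have hleaf : ∀ i ∈ S, ‖∫ s in Icc (a i) (b i), F s‖ ≤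
      min (max 0 (b i - a i)) (1 / (Real.pi * |k i|)) + 2 * Real.pi * E * max 0 (b i - a i) := by
    intro i hi
    rcases le_or_gt (a i) (b i) with hab | hab
    · rw [max_eq_right (sub_nonneg.2 hab), integral_Icc_eq_integral_Ioc, ← intervalIntegral.integral_of_le hab]
      have hsub : Icc (a i) (b i) ⊆ Icc (u i) (v i) := by rw [← hcut]; exact inter_subset_left
      exact norm_integral_sin_piece_le hφ hab (hk i hi) hE fun s hs s' hs' => haff i hi s (hsub hs) s' (hsub hs')
    · rw [Icc_eq_empty (not_le.mpr hab), Measure.restrict_empty, integral_zero_measure, norm_zero,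
        max_eq_left (sub_nonpos.2 hab.le), min_eq_left (by positivity), mul_zero, add_zero]
  -- the rest
  have hrest : ‖∫ s in Icc α β \ U, F s‖ ≤ (volume (D ∩ Icc α β)).toReal := by
    have hsub : Icc α β \ U ⊆ D ∩ Icc α β := by
      intro s hs
      refine ⟨?_, hs.1⟩
      rcases hcover s ⟨hα.trans hs.1.1, hs.1.2.trans hβ⟩ with ⟨i, hi, hsi⟩ | hD
      · exact absurd (mem_iUnion₂.mpr ⟨i, hi, by rw [← hcut]; exact ⟨hsi, hs.1⟩⟩) hs.2
      · exact hD
    have hlt : volume (Icc α β \ U) < ⊤ := lt_of_le_of_lt (measure_mono sdiff_subset) hvolw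
    refine (norm_setIntegral_le_of_norm_le_const hlt fun s _ => hF1 s).trans ?_
    rw [one_mul]
    exact ENNReal.toReal_mono (lt_of_le_of_lt (measure_mono inter_subset_right) hvolw).ne (measure_mono hsub)
  -- lengths of the cut pieces add up to at most `β − α`
  have hlen : ∑ i ∈ S, max 0 (b i - a i) ≤ β - α :=
    sum_length_children_le S hαβ (fun i _ => by rw [← hcut]; exact inter_subset_right) fun i hi i' hi' hne => hdisj' i hi i' hi' hne
  rw [hsplit]
  calc ‖(∑ i ∈ S, ∫ s in Icc (a i) (b i), F s) + ∫ s in Icc α β \ U, F s‖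
      ≤ ∑ i ∈ S, ‖∫ s in Icc (a i) (b i), F s‖ + ‖∫ s in Icc α β \ U, F s‖ :=
        (norm_add_le _ _).trans (add_le_add (norm_sum_le _ _) le_rfl)
    _ ≤ ∑ i ∈ S, (min (max 0 (b i - a i)) (1 / (Real.pi * |k i|)) + 2 * Real.pi * E * max 0 (b i - a i)) +
          (volume (D ∩ Icc α β)).toReal := by
        gcongr with i hi
        exact hleaf i hi
    _ = ∑ i ∈ S, min (max 0 (b i - a i)) (1 / (Real.pi * |k i|)) + 2 * Real.pi * E * ∑ i ∈ S, max 0 (b i - a i) +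
          (volume (D ∩ Icc α β)).toReal := by
        rw [Finset.sum_add_distrib, Finset.mul_sum]
    _ ≤ ∑ i ∈ S, min (max 0 (b i - a i)) (1 / (Real.pi * |k i|)) + 2 * Real.pi * E * (β - α) +
          (volume (D ∩ Icc α β)).toReal := by
        gcongr

/-! ## §3 On the cascade chord -/

section Cascade

variable (P : CascadeParams)

/-- **The window integrals of the inviscid iterate along a chord** (the refinement of `…LineRefineCascadeLt.lineRefine_cascade_lt` made
explicit for the strip channel): there are finitely many pairwise disjoint pieces `[u_i, v_i] ⊆ [0, 1]` of total length `≤ 1` with slopes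
`|k_i| ≥ (γ²−3)^n`, `Σ_i |k_i|⁻¹ ≤ B_n`, such that for all `0 ≤ α ≤ β ≤ 1`
`‖∫_α^β sin(2π(z_s 0)₀) ds‖ ≤ Σ_i min(|[u_i,v_i] ∩ [α,β]|, 1/(π|k_i|)) + 2πE_V(β − α) + |NEAR_Y ∩ [α, β]|`.
[cite: ElgindiLissMattingly2025, §1.2.2, §3.1] [cite: Grafakos2014, Prop. 3.1.2] -/
theorem window_sum_le_lt (hγ : 1 ≤ P.γ) (h8 : 8 ≤ P.γ ^ 2) (hδ₀ : 0 < P.δ₀) (hd : 0 < P.d) (hN₀ : 1 ≤ P.N₀) (hρ : 1 ≤ P.ρN)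
    {M₁ M₂ : ℝ} (hM₁ : 0 < M₁) (hM : 1 ≤ M₂) (hMδ : ∀ j, M₂ * P.δ j < Real.pi / 2) {n : ℕ} (Y : EuclideanSpace ℝ (Fin 2))
    (z : ℝ → ℕ → EuclideanSpace ℝ (Fin 2)) (hzn : ∀ s, z s n = Y + s • EuclideanSpace.single 0 1)
    (hz : ∀ s, ∀ j < n, z s j = shearMapLift 0 1 (amp ⟨P.U j, P.U_periodic j, P.contDiff_U (P.δ_pos hδ₀ hd j)⟩ P.γ)
      (shearMapLift 1 0 (amp ⟨P.U j, P.U_periodic j, P.contDiff_U (P.δ_pos hδ₀ hd j)⟩ P.γ) (z s (j + 1))))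
    {EV EH : ℝ} (B : ℕ → ℝ) (hEV0 : 0 ≤ EV)
    (hEV : ∀ ℓ, ℓ ≤ n → (∑ i ∈ Finset.range ℓ, (1 + P.γ + P.γ ^ 2) ^ i *
        ((P.γ ^ 2 * (1 / (2 * P.N (n - ℓ + i)) - M₂ * P.δ (n - ℓ + i) / (Real.pi * P.N (n - ℓ + i))) +
          P.γ * (1 / (2 * P.N (n - ℓ + i)) - M₂ * P.δ (n - ℓ + i) / (Real.pi * P.N (n - ℓ + i)))) *
          (2 * Real.exp (-(M₂ ^ 2 / 2))))) ≤ EV)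
    (hEH : (1 + P.γ) * EV + P.γ * (2 * Real.exp (-(M₂ ^ 2 / 2))) * ((1 + P.γ + P.γ ^ 2) ^ n + EV) ≤ EH)
    (hζV : ∀ j, j < n → M₂ * P.δ j / (2 * Real.pi * P.N j) + EV ≤ M₁ * P.δ j / (2 * Real.pi * P.N j))
    (hζH : ∀ j, j < n → M₂ * P.δ j / (2 * Real.pi * P.N j) + EH ≤ M₁ * P.δ j / (2 * Real.pi * P.N j))
    (hB0 : ((P.γ ^ 2 - 3) ^ n)⁻¹ ≤ B 0)
    (hB : ∀ ℓ, ℓ < n → 4 * B ℓ + 2 * P.N (n - ℓ - 1) * (P.γ + 2 + 2 / P.γ) / (P.γ ^ 2 - 3) ^ (n - ℓ) ≤ B (ℓ + 1)) :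
    ∃ (ι : Type) (S : Finset ι) (u v kk : ι → ℝ),
      (∀ i ∈ S, u i ≤ v i ∧ Icc (u i) (v i) ⊆ Icc (0 : ℝ) 1) ∧
      (∀ i ∈ S, ∀ i' ∈ S, i ≠ i' → Disjoint (Icc (u i) (v i)) (Icc (u i') (v i'))) ∧
      (∑ i ∈ S, (v i - u i) ≤ 1) ∧
      (∀ i ∈ S, (P.γ ^ 2 - 3) ^ n ≤ |kk i|) ∧
      (∑ i ∈ S, |kk i|⁻¹ ≤ B n) ∧
      ∀ α β : ℝ, 0 ≤ α → α ≤ β → β ≤ 1 →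
        ‖∫ s in α..β, (Real.sin (2 * Real.pi * (z s 0) 0) : ℂ)‖ ≤
          ∑ i ∈ S, min (max 0 (min (v i) β - max (u i) α)) (1 / (Real.pi * |kk i|)) + 2 * Real.pi * EV * (β - α) +
            (volume ({s : ℝ | ∃ j', j' < n ∧ ∃ q : ℤ,
          |(z s (j' + 1)) 0 - ((q : ℝ) / 2 + 1 / 4) / P.N j'| < M₁ * P.δ j' / (2 * Real.pi * P.N j') + EV ∨
          |((z s (j' + 1)) 1 - P.γ * P.U j' ((z s (j' + 1)) 0)) - ((q : ℝ) / 2 + 1 / 4) / P.N j'| <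
            M₁ * P.δ j' / (2 * Real.pi * P.N j') + EH} ∩ Icc α β)).toReal := by
  have hγ0 : 0 < P.γ := by linarith
  have hg3 : 0 < P.γ ^ 2 - 3 := by nlinarith
  obtain ⟨ι, S, u, v, pV, pH, hpiece, hdisj, hlen, hgood, hpot, hcover⟩ :=
    lineRefine_cascade_lt P hγ h8 hδ₀ hd hN₀ hρ hM₁ hM hMδ Y z hzn hz B (fun ℓ hℓ => hEV ℓ hℓ.le) hEH hζV hζH hB0 hB
  have hφ : Continuous fun s => (z s 0) 0 :=
    (EuclideanSpace.proj (0 : Fin 2)).continuous.comp (continuous_traj P hδ₀ hd Y z hzn hz (Nat.zero_le n))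
  have hEVn := hEV n le_rfl
  simp only [Nat.sub_self, zero_add, pow_zero, one_mul] at hgood hpot hcover hEVn
  have hsl : ∀ i, IsSignList ((List.range n).map fun k =>
      (-(1 - 2 * ((pH i k % 2 : ℤ) : ℝ)), -(1 - 2 * ((pV i k % 2 : ℤ) : ℝ)))) ∧
      ((List.range n).map fun k => (-(1 - 2 * ((pH i k % 2 : ℤ) : ℝ)), -(1 - 2 * ((pV i k % 2 : ℤ) : ℝ)))).length = n := by
    intro i
    have h := isSignList_pieceItin (pV i) (pH i) 0 n
    simp only [zero_add] at h
    exact h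
  set kk : ι → ℝ := fun i => itinJac P.γ ((List.range n).map fun k =>
      (-(1 - 2 * ((pH i k % 2 : ℤ) : ℝ)), -(1 - 2 * ((pV i k % 2 : ℤ) : ℝ)))) 0 0 with hkk
  have hslope : ∀ i, (P.γ ^ 2 - 3) ^ n ≤ |kk i| := fun i => by
    have h := (slopes_piece hγ0 h8 (hsl i).1).1
    rw [(hsl i).2] at h
    exact h
  have hk0 : ∀ i ∈ S, kk i ≠ 0 := fun i _ h => by
    have := hslope i; rw [h, abs_zero] at this; exact absurd this (not_le.mpr (pow_pos hg3 n))
  refine ⟨ι, S, u, v, kk, hpiece, hdisj, hlen, fun i _ => hslope i, hpot, fun α β hα hαβ hβ => ?_⟩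
  refine norm_window_integral_le hφ S u v kk hEV0 hdisj ?_ hk0 _ ?_ hα hαβ hβ
  · intro i hi s hs s' hs'
    have htraj := norm_traj_sub_sub_itinJac_le P hγ hδ₀ hd hN₀ hρ hM hMδ (Nat.zero_le n) Y z hzn hz (pV i) (pH i)
      (fun t ht j h0 hj => hgood i hi t ht j h0 hj) hs hs'
    simp only [Nat.sub_zero, zero_add] at htraj
    exact (abs_coord_sub_sub_le_of_norm_le htraj 0).trans hEVn
  · intro s hs
    rcases hcover s hs with h | ⟨j', _, hj', q, hq⟩
    · exact Or.inl h
    · exact Or.inr ⟨j', hj', q, hq⟩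

end Cascade

end Summit.AnomalousDissipation.AnomalousDissipation.Theorems.SawtoothPulseCascade.K1Start
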